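import Summits.CriticalPhenomena.PercolationContinuityZ3.Theorems.PercNearOneGluingNoHeavyLowerTailSpectatorTriangleRowAllN
import HarnessLib

/-!
# `NoHeavyLowerTail` (crux stmt-CriticalPhenomena-4575), four-point law: EVERY conditional Gladkov–Zimin row on the three-point pattern poset `M₃`
# given an isolated vertex set — general kernels (label form and cell form)

Support file (prover seat `prim-l12-p1` gen 5; `--supports stmt-CriticalPhenomena-4575`; one bookkeeping `def` (`cellM3`), standard axioms, no `native_decide`).
Sequel of `…ConditionalThreePointAG` / `…ConditionalThreePointAGSet` (prim-l12-p2 gen 4: Gladkov–Zimin Cor. 3.5 with the ONE kernel `Kz`, via the transfer principle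
`BHK2006_twoSetConditional_transfer` of `Literature/…/TwoClusterGibbsSampler`) and of `…SpectatorTriangleRowAllN` (the cell identifications).

* `m3_kernel_ineq_gen` — GZ Thm 2.3 on the `M₃`-label masses of any monotone image of a product measure, ARBITRARY kernel with the exchange condition
  `A x t + A y z ≤ A x z + A y t` (`x ≤ y`, `z ≤ t`);
* `condKernel_isolatedSet_lab` — the transfer: with `D_T = {a,b,c ↮ T}`, `m_l = μ(D_T ∩ {lab3 a b c = l})`, `M = μ(D_T)`:
  `Σ_{l,l'} A l l' m_l m_{l'} ≤ M · Σ_l A l l m_l` for every weight function (closure principle in the weights + degenerate case, as in `condAG_isolatedSet_lab`);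
* `spectatorKernel_all` — the same on `Fin n` in the cell vocabulary of `…SpectatorTriangleRowLeFive` (cells `cellM3 a b c y l`), conditioning event `D[abc|y]`.
This is the whole cone "CGZ₃ with a spectator (set)" of the law-level certificate searches of prim-bnk-1 (gen 13–14, conjecture 'CGZ'; memo
run/shared/lean/prim/prim-l12/FROM-prim-bnk-1-gen13-COMB2-ROWS.md §3(e)) as theorems, so that certificates using these rows replay; `A = Kz` is `spectatorTriangle_all`.
[cite: GladkovZimin2024HK, §3.2, Thm. 2.3, Cor. 3.5]; [cite: VandenbergHaggstromKahn2005, §2.1]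
-/

noncomputable section

open MeasureTheory Set
open Literature.Probability.LatticeModels
open Literature.Probability.Percolation

namespace Summit.CriticalPhenomena.PercolationContinuityZ3.Theorems.CutVertexMinors

open M3Lab
open scoped Classical

universe u

variable {V : Type u}

/-! ## Gladkov–Zimin Thm 2.3 on `M₃` for an arbitrary kernel, for every monotone image of a product measure -/

/-- **Any GZ kernel on the `M₃`-label masses of a monotone image of a product measure** (the transfer hypothesis): for
`g : Set β → Set (Sym2 V) × Set (Sym2 V)` with increasing first component, `m_l = μ_q{x | lab3 (g x).1 = l}` and a kernel `A` with the exchange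
condition, `Σ_{l,l'} A l l' m_l m_{l'} ≤ Σ_l A l l m_l`. [cite: GladkovZimin2024HK, Thm. 2.3] -/
theorem m3_kernel_ineq_gen {β : Type u} [Fintype β] (q : β → unitInterval) (a b c : V)
    (g : Set β → Set (Sym2 V) × Set (Sym2 V)) (hg : ∀ x x', x ⊆ x' → (g x).1 ⊆ (g x').1)
    (A : M3Lab → M3Lab → ℝ) (hA : ∀ ⦃x y z t : M3Lab⦄, x ≤ y → z ≤ t → A x t + A y z ≤ A x z + A y t) :
    ∑ l : M3Lab, ∑ l' : M3Lab, A l l' * ((prodBernoulli q).real {x | lab3 a b c (g x).1 = l} * (prodBernoulli q).real {x | lab3 a b c (g x).1 = l'}) ≤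
      ∑ l : M3Lab, A l l * (prodBernoulli q).real {x | lab3 a b c (g x).1 = l} :=
  gz_labelClass_le q (fun x => lab3 a b c (g x).1) (fun x x' h => lab3_mono a b c (hg x x' h)) Finset.univ (fun _ => Finset.mem_univ _) A hA

/-! ## The conditional kernel rows given an isolated vertex set -/

/-- Integral of a `0/1` function of a label. [folklore] -/
private theorem integral_ite_eq_real₃ {Ω : Type*} [MeasurableSpace Ω] [MeasurableSingletonClass Ω] [Fintype Ω]
    (μ : Measure Ω) [IsFiniteMeasure μ] (p : Ω → Prop) [DecidablePred p] :
    ∫ x, (if p x then (1 : ℝ) else 0) ∂μ = μ.real {x | p x} := by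
  have h : (fun x => if p x then (1 : ℝ) else 0) = Set.indicator {x | p x} 1 := by
    funext x
    by_cases hx : p x
    · rw [if_pos hx, Set.indicator_of_mem (show x ∈ {x | p x} from hx), Pi.one_apply]
    · rw [if_neg hx, Set.indicator_of_notMem (show x ∉ {x | p x} from hx)]
  rw [h, integral_indicator_one (MeasurableSet.of_discrete)]

/-- Reachability between points of `S` is the same in `ω` and in the union `C_S(ω)` of their open edge clusters. [folklore] -/
private theorem reachable_setCl_iff₃ {S : Set V} {s v : V} (hs : s ∈ S) (ω : BondConfig V) :
    (openGraph (⋃ s ∈ S, openEdgeCluster ω s)).Reachable s v ↔ (openGraph ω).Reachable s v := by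
  constructor
  · intro h
    exact h.mono (BHK2006.openGraph_le (Set.iUnion₂_subset fun s _ => openEdgeCluster_subset ω s))
  · rintro ⟨p⟩
    have hp : ∀ e' ∈ p.edges, e' ∈ (openGraph (⋃ s ∈ S, openEdgeCluster ω s)).edgeSet := fun e' he' => by
      have h1 : e' ∈ openEdgeCluster ω s := TwoSetExchange.edge_mem_openEdgeCluster_of_walk p e' he'
      have h2 := ((mem_openEdgeCluster_iff ω s e').1 h1).2.1
      change e' ∈ (SimpleGraph.fromEdgeSet (⋃ s ∈ S, openEdgeCluster ω s)).edgeSet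
      rw [SimpleGraph.edgeSet_fromEdgeSet]
      exact ⟨Set.mem_biUnion hs h1, h2⟩
    exact ⟨p.transfer _ hp⟩

/-- The label of the true state `(C_S(ω), C_T(ω))`, `S = {a,b,c}`, is the label of `ω`. [folklore] -/
private theorem lab3_setCl₃ (a b c : V) (ω : BondConfig V) :
    lab3 a b c (⋃ s ∈ ({a, b, c} : Set V), openEdgeCluster ω s) = lab3 a b c ω := by
  have ha : a ∈ ({a, b, c} : Set V) := mem_insert a {b, c}
  have hb : b ∈ ({a, b, c} : Set V) := mem_insert_of_mem a (mem_insert b {c})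
  unfold lab3
  simp only [reachable_setCl_iff₃ ha, reachable_setCl_iff₃ hb]

variable [Fintype V]

/-- **Every conditional Gladkov–Zimin row on `M₃` given an isolated vertex set** (label form).  For every weight function, vertices `a, b, c`, vertex set
`T`, kernel `A` on `M₃` with `A x t + A y z ≤ A x z + A y t` (`x ≤ y`, `z ≤ t`), with `D_T = {a,b,c ↮ T}`, `m_l = μ(D_T ∩ {lab3 a b c = l})`:
`Σ_{l,l'} A l l' m_l m_{l'} ≤ μ(D_T) · Σ_l A l l m_l`.  (`A = Kz`: `condAG_isolatedSet_lab`.)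
[cite: GladkovZimin2024HK, §3.2 with Thm. 2.3 — corollary, derived in this file] -/
theorem condKernel_isolatedSet_lab (w : Sym2 V → unitInterval) (a b c : V) (T : Set V) (A : M3Lab → M3Lab → ℝ)
    (hA : ∀ ⦃x y z t : M3Lab⦄, x ≤ y → z ≤ t → A x t + A y z ≤ A x z + A y t) :
    ∑ l : M3Lab, ∑ l' : M3Lab, A l l' *
        ((prodBernoulli w).real ({ω : BondConfig V | ∀ s ∈ ({a, b, c} : Set V), ∀ t ∈ T, ¬ (openGraph ω).Reachable s t} ∩ {ω | lab3 a b c ω = l}) *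
          (prodBernoulli w).real ({ω : BondConfig V | ∀ s ∈ ({a, b, c} : Set V), ∀ t ∈ T, ¬ (openGraph ω).Reachable s t} ∩ {ω | lab3 a b c ω = l'})) ≤
      (prodBernoulli w).real {ω : BondConfig V | ∀ s ∈ ({a, b, c} : Set V), ∀ t ∈ T, ¬ (openGraph ω).Reachable s t} *
        ∑ l : M3Lab, A l l *
          (prodBernoulli w).real ({ω : BondConfig V | ∀ s ∈ ({a, b, c} : Set V), ∀ t ∈ T, ¬ (openGraph ω).Reachable s t} ∩ {ω | lab3 a b c ω = l}) := by
  classical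
  set D : Set (BondConfig V) := {ω | ∀ s ∈ ({a, b, c} : Set V), ∀ t ∈ T, ¬ (openGraph ω).Reachable s t} with hDdef
  by_cases hd : a ∈ T ∨ b ∈ T ∨ c ∈ T
  · -- degenerate: `D = ∅`
    have hDe : D = ∅ := by
      refine Set.eq_empty_iff_forall_notMem.2 fun ω hω => ?_
      rcases hd with h | h | h
      · exact hω a (mem_insert a {b, c}) a h (SimpleGraph.Reachable.refl a)
      · exact hω b (mem_insert_of_mem a (mem_insert b {c})) b h (SimpleGraph.Reachable.refl b)
      · exact hω c (mem_insert_of_mem a (mem_insert_of_mem b (mem_singleton c))) c h (SimpleGraph.Reachable.refl c)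
    simp only [hDe, empty_inter, measureReal_empty, mul_zero, Finset.sum_const_zero, le_refl]
  simp only [not_or] at hd
  obtain ⟨hda, hdb, hdc⟩ := hd
  have hDne : D.Nonempty := by
    refine ⟨∅, fun s hs t ht hr => ?_⟩
    have hbot : openGraph (∅ : BondConfig V) = ⊥ := SimpleGraph.fromEdgeSet_empty
    rw [hbot, SimpleGraph.reachable_bot] at hr
    subst hr
    rcases hs with rfl | rfl | rfl
    · exact hda ht
    · exact hdb ht
    · exact hdc ht
  refine weights_le_of_forall_pos_lt_one
    (f := fun p : Sym2 V → unitInterval => ∑ l : M3Lab, ∑ l' : M3Lab, A l l' *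
      ((prodBernoulli p).real (D ∩ {ω | lab3 a b c ω = l}) * (prodBernoulli p).real (D ∩ {ω | lab3 a b c ω = l'})))
    (g := fun p : Sym2 V → unitInterval => (prodBernoulli p).real D * ∑ l : M3Lab, A l l * (prodBernoulli p).real (D ∩ {ω | lab3 a b c ω = l}))
    ?_ ?_ (fun p hp => ?_) w
  · exact continuous_finsetSum _ fun l _ => continuous_finsetSum _ fun l' _ =>
      continuous_const.mul ((prodBernoulli_real_continuous _).mul (prodBernoulli_real_continuous _))
  · exact (prodBernoulli_real_continuous _).mul (continuous_finsetSum _ fun l _ => continuous_const.mul (prodBernoulli_real_continuous _))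
  · have hT : ∀ e : Sym2 V, ¬ e.IsDiag → (∃ v ∈ e, v ∈ T) → (p e : ℝ) < 1 :=
      fun e _ _ => unitInterval.coe_lt_one.2 (hp e).2
    have hD : 0 < (prodBernoulli p).real D := prodBernoulli_real_pos_of_nonempty hp hDne
    -- an injective index of the five labels for the `Fin`-indexed test functions of the transfer principle
    set idx : M3Lab → Fin (Fintype.card M3Lab) := fun l => Fintype.equivFin M3Lab l with hidx
    have idx_inj : ∀ l l' : M3Lab, idx l = idx l' → l = l' := fun l l' h => (Fintype.equivFin M3Lab).injective h
    -- the polynomial `Σ_l A l l m_l − Σ_{l,l'} A l l' m_l m_l'` in the five masses, transferred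
    have hP : Continuous fun m : Fin (Fintype.card M3Lab) → ℝ => ∑ l : M3Lab, A l l * m (idx l) - ∑ l : M3Lab, ∑ l' : M3Lab, A l l' * (m (idx l) * m (idx l')) := by
      refine Continuous.sub ?_ ?_
      · exact continuous_finsetSum _ fun l _ => continuous_const.mul (continuous_apply _)
      · exact continuous_finsetSum _ fun l _ => continuous_finsetSum _ fun l' _ =>
          continuous_const.mul ((continuous_apply _).mul (continuous_apply _))
    have hset : ∀ (E : Set (Sym2 V) → M3Lab) (l : M3Lab) (X : Type u) (h : X → Set (Sym2 V)),
        {x : X | idx (E (h x)) = idx l} = {x | E (h x) = l} := by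
      intro E l X h
      ext x
      simp only [mem_setOf_eq]
      exact ⟨fun h1 => idx_inj _ _ h1, fun h1 => by rw [h1]⟩
    have key := BHK2006_twoSetConditional_transfer p ({a, b, c} : Set V) T hT hD
      (fun (i : Fin (Fintype.card M3Lab)) (x : Set (Sym2 V) × Set (Sym2 V)) => if idx (lab3 a b c x.1) = i then (1 : ℝ) else 0) hP
      fun β _ q g hg => by
        have hg1 : ∀ x x', x ⊆ x' → (g x).1 ⊆ (g x').1 := fun x x' h => (hg x x' h).1
        have h := m3_kernel_ineq_gen q a b c g hg1 A hA
        simp only [integral_ite_eq_real₃]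
        have hl : ∀ l : M3Lab, (prodBernoulli q).real {x : Set β | idx (lab3 a b c (g x).1) = idx l} =
            (prodBernoulli q).real {x | lab3 a b c (g x).1 = l} := fun l => by rw [hset (lab3 a b c) l (Set β) (fun x => (g x).1)]
        simp only [hl]
        linarith
    simp only [lab3_setCl₃] at key
    -- the restricted integrals are the masses of `D ∩ {lab = l}`
    have hint : ∀ l : M3Lab, ∫ ω in D, (if idx (lab3 a b c ω) = idx l then (1 : ℝ) else 0) ∂(prodBernoulli p) =
        (prodBernoulli p).real (D ∩ {ω | lab3 a b c ω = l}) := by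
      intro l
      have h : (fun ω : BondConfig V => if idx (lab3 a b c ω) = idx l then (1 : ℝ) else 0) =
          Set.indicator {ω | lab3 a b c ω = l} 1 := by
        funext ω
        by_cases hω : lab3 a b c ω = l
        · rw [if_pos (by rw [hω]), Set.indicator_of_mem (show ω ∈ {ω | lab3 a b c ω = l} from hω), Pi.one_apply]
        · rw [if_neg (fun h => hω (idx_inj _ _ h)), Set.indicator_of_notMem (show ω ∉ {ω | lab3 a b c ω = l} from hω)]
      rw [h, integral_indicator_one MeasurableSet.of_discrete, measureReal_restrict_apply MeasurableSet.of_discrete,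
        inter_comm]
    rw [← hDdef] at key
    simp only [hint] at key
    -- clear denominators: `0 ≤ Σ A_ll m_l/Z − Σ A m_l m_l'/Z²` ⇒ `Σ A m m ≤ Z Σ A_ll m_l`
    set Z := (prodBernoulli p).real D with hZ
    set m : M3Lab → ℝ := fun l => (prodBernoulli p).real (D ∩ {ω | lab3 a b c ω = l}) with hm
    have key' : 0 ≤ ∑ l : M3Lab, A l l * (m l / Z) - ∑ l : M3Lab, ∑ l' : M3Lab, A l l' * (m l / Z * (m l' / Z)) := key
    have e1 : ∑ l : M3Lab, A l l * (m l / Z) = (∑ l : M3Lab, A l l * m l) / Z := by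
      rw [Finset.sum_div]; exact Finset.sum_congr rfl fun l _ => by ring
    have e2 : ∑ l : M3Lab, ∑ l' : M3Lab, A l l' * (m l / Z * (m l' / Z)) = (∑ l : M3Lab, ∑ l' : M3Lab, A l l' * (m l * m l')) / (Z * Z) := by
      rw [Finset.sum_div]; refine Finset.sum_congr rfl fun l _ => ?_
      rw [Finset.sum_div]; exact Finset.sum_congr rfl fun l' _ => by field_simp
    rw [e1, e2] at key'
    have hZZ : 0 < Z * Z := mul_pos hD hD
    have h3 : (∑ l : M3Lab, ∑ l' : M3Lab, A l l' * (m l * m l')) / (Z * Z) ≤ (∑ l : M3Lab, A l l * m l) / Z := by linarith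
    rw [div_le_div_iff₀ hZZ hD] at h3
    have h4 : (∑ l : M3Lab, ∑ l' : M3Lab, A l l' * (m l * m l')) * Z ≤ (∑ l : M3Lab, A l l * m l) * (Z * Z) := h3
    nlinarith [h4, hD]

end CutVertexMinors

namespace SpectatorTriangleRow

open OneCutCert CovTransferCert E3GroupSepCert CutVertexMinors CutVertexMinors.M3Lab
open scoped Classical

variable {n : ℕ}

/-- The five `y`-isolated cells of `…SpectatorTriangleRowLeFive`, indexed by the `M₃`-label of `(a, b, c)`. [this work] -/
def cellM3 (a b c y : Fin n) : M3Lab → (CRel n → Bool)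
  | .bot => cNone a b c y
  | .ab => cAB a b c y
  | .ac => cAC a b c y
  | .bc => cBC a b c y
  | .top => cABC_Y a b c y

/-- **Each `y`-isolated cell is the corresponding conditioned-label event.** [this work] -/
theorem connEvent_cellM3 (a b c y : Fin n) (l : M3Lab) : connEvent (cellM3 a b c y l) =
    {ω : BondConfig (Fin n) | ∀ s ∈ ({a, b, c} : Set (Fin n)), ∀ t ∈ ({y} : Set (Fin n)), ¬ (openGraph ω).Reachable s t} ∩ {ω | lab3 a b c ω = l} := by
  cases l
  · exact connEvent_cNone_eq a b c y
  · exact connEvent_cAB_eq a b c y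
  · exact connEvent_cAC_eq a b c y
  · exact connEvent_cBC_eq a b c y
  · exact connEvent_cABC_Y_eq a b c y

/-- **Every conditional Gladkov–Zimin row on the `y`-isolated four-point cells, all `n`** (cell vocabulary of `…SpectatorTriangleRowLeFive`).  For ANY kernel
`A` on `M₃` with the exchange condition, every `n`, every weight vector and all `a b c y : Fin n` (no distinctness needed):
`Σ_{l,l'} A l l' · pr(cell_l) pr(cell_{l'}) ≤ pr(D[abc|y]) · Σ_l A l l · pr(cell_l)`, cells `cNone, cAB, cAC, cBC, cABC_Y`. [this work] -/
theorem spectatorKernel_all (A : M3Lab → M3Lab → ℝ) (hA : ∀ ⦃x x' z z' : M3Lab⦄, x ≤ x' → z ≤ z' → A x z' + A x' z ≤ A x z + A x' z')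
    (w : Sym2 (Fin n) → unitInterval) (a b c y : Fin n) :
    ∑ l : M3Lab, ∑ l' : M3Lab, A l l' * (pr w (cellM3 a b c y l) * pr w (cellM3 a b c y l')) ≤
      pr w (sep [a, b, c] [y]) * ∑ l : M3Lab, A l l * pr w (cellM3 a b c y l) := by
  unfold pr
  simp only [connEvent_cellM3, connEvent_sep_abc_y]
  exact condKernel_isolatedSet_lab w a b c {y} A hA

/-- Sums over `M₃`, expanded. [folklore] -/
theorem M3Lab_sum_univ {M : Type*} [AddCommMonoid M] (f : M3Lab → M) : ∑ x, f x = f .bot + f .ab + f .ac + f .bc + f .top := by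
  have h : (Finset.univ : Finset M3Lab) = {M3Lab.bot, M3Lab.ab, M3Lab.ac, M3Lab.bc, M3Lab.top} := by decide
  rw [h]
  simp [Finset.sum_insert, add_assoc]

end SpectatorTriangleRow

end Summit.CriticalPhenomena.PercolationContinuityZ3.Theorems
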